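import Mathlib
import Literature.Probability.Percolation.PercolationProofs
import Summits.CriticalPhenomena.PercolationContinuityZ3.Theorems.PercNearOneGluingAdditiveGluingSigmaRecursion
import HarnessLib

/-! # Crux `PercNearOneGluing.AdditiveGluing` (stmt-CriticalPhenomena-4576), line `subuniform-dead-pocket-maximum` —
two exact reductions for the inductive step `stub_goodStep` (siege k22, variation "induction on `|A ∖ b|`")

The stub asks for Kozma–Nitzan goodness (arXiv:2401.12397 §3.2 p. 12) of EVERY quadruple `(w, A, o, b)` with
`b ∈ A ∌ o`, in the skeleton's linear selection form
`Φ(A) + Σ_{W ∋ o, W ∩ A = ∅} μ(C(o) = W) · μ((sel W ↔ b in Wᶜ)ᶜ) ≤ t` for every level `t` with `1 − t ≤ μ(a ↔ b)`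
on `A` and every selection `sel W ∈ A` (`Φ(A) = μ(o ↔ A, o ↮ b)` the live failure).  This helper file proves the
two "without loss of generality" steps of an induction on the relay set:

* `goodSat_of_le_observer` — **high observer**: if `1 − t ≤ μ(o ↔ b)` the inequality holds outright (live failure
  and dead pockets are disjoint sub-events of `{o ↮ b}`);
* `goodSat_mono` — **monotonicity in the relay set**: at a fixed level `t`, the inequality for `A` and all
  selections into `A` implies it for every `S ⊆ A` with `b ∈ S` and all selections into `S` (the pockets dead for
  `S` but not for `A` are sub-events of the live failure of `A`);
* `goodSat_reduction` — consequently goodness of all quadruples at level `t` follows from goodness of the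
  SATURATED ones: `A ⊇ {x | 1 − t ≤ μ(x ↔ b)}` (the whole super-level set, Kozma–Nitzan §5.6 (4)) with the observer
  strictly below the level, `μ(o ↔ b) < 1 − t`.

In the two-point language of the line (`GOOD ⟺ X + Pen ≤ Y`), `goodSat_mono` says that goodness is monotone
INCREASING in strength along `|A ∖ b|` once the worst relay is kept, so an induction on `|A ∖ b|` can only
descend; the content of each upward step `k − 1 → k` (`k ≥ 3`) contains Kozma–Nitzan's Question 7 for `k`
relays (siege notes, NOTES.md §Census).  No new definitions; lands with `--supports stmt-CriticalPhenomena-4576`. -/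

namespace Summit.CriticalPhenomena.PercolationContinuityZ3.Theorems

open MeasureTheory Set
open Literature.Probability.LatticeModels (prodBernoulli)
open Literature.Probability.Percolation (BondConfig openConn openConnIn openGraph openCluster
  openGraph_adj)
open scoped BigOperators

noncomputable section
open Classical

variable {n : ℕ}

/-- The event `{C(o) = W}` is the fibre over `W` of the cluster map `ω ↦ {x | x ∈ C(o)}` (as a `Finset`).
[folklore] -/
theorem goodSat_preimage_cluster (o : Fin n) (W : Finset (Fin n)) :
    (fun ω : BondConfig (Fin n) => Finset.univ.filter fun x : Fin n => x ∈ openCluster ω o) ⁻¹' {W} =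
      {ω : BondConfig (Fin n) | openCluster ω o = (W : Set (Fin n))} := by
  ext ω
  simp only [Set.mem_preimage, Set.mem_singleton_iff, Set.mem_setOf_eq, Finset.ext_iff,
    Finset.mem_filter, Finset.mem_univ, true_and, Set.ext_iff, Finset.mem_coe]

/-- **Pocket sums are sub-probabilities.** If every pocket `W` with `P W` forces `C(o) = W ⊆ F`-membership,
then `Σ_{W, P W} μ(C(o) = W) · c_W ≤ μ(F)` for weights `0 ≤ c_W ≤ 1` (the events `{C(o) = W}` are the disjoint
fibres of the cluster map). [folklore] -/
theorem goodSat_pocket_sum_le (w : Sym2 (Fin n) → unitInterval) (o : Fin n) (P : Finset (Fin n) → Prop)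
    [DecidablePred P] (c : Finset (Fin n) → ℝ) (hc : ∀ W, c W ≤ 1) (F : Set (BondConfig (Fin n)))
    (hF : ∀ W, P W → {ω : BondConfig (Fin n) | openCluster ω o = (W : Set (Fin n))} ⊆ F) :
    ∑ W ∈ (Finset.univ : Finset (Finset (Fin n))).filter (fun W => P W),
        (prodBernoulli w).real {ω : BondConfig (Fin n) | openCluster ω o = (W : Set (Fin n))} * c W ≤
      (prodBernoulli w).real F := by
  set f : BondConfig (Fin n) → Finset (Fin n) :=
    fun ω => Finset.univ.filter fun x : Fin n => x ∈ openCluster ω o with hf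
  calc ∑ W ∈ (Finset.univ : Finset (Finset (Fin n))).filter (fun W => P W),
        (prodBernoulli w).real {ω : BondConfig (Fin n) | openCluster ω o = (W : Set (Fin n))} * c W
      ≤ ∑ W ∈ (Finset.univ : Finset (Finset (Fin n))).filter (fun W => P W),
          (prodBernoulli w).real {ω : BondConfig (Fin n) | openCluster ω o = (W : Set (Fin n))} :=
        Finset.sum_le_sum fun W _ => mul_le_of_le_one_right measureReal_nonneg (hc W)
    _ = ∑ W ∈ (Finset.univ : Finset (Finset (Fin n))).filter (fun W => P W),
          (prodBernoulli w).real (f ⁻¹' {W} ∩ F) := by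
        refine Finset.sum_congr rfl fun W hW => ?_
        rw [hf, goodSat_preimage_cluster o W,
          Set.inter_eq_left.2 (hF W (Finset.mem_filter.1 hW).2)]
    _ ≤ ∑ W, (prodBernoulli w).real (f ⁻¹' {W} ∩ F) :=
        Finset.sum_le_univ_sum_of_nonneg fun W => measureReal_nonneg
    _ = (prodBernoulli w).real F := sigmaRec_sum_preimage_inter w f F

/-- A dead pocket is a sub-event of "no relay and not the target in `C(o)`": if `C(o) = W` with `W ∩ A = ∅`
and `b ∈ A`, then `o ↮ b` and `o ↮ a` for all `a ∈ A`. [folklore] -/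
theorem goodSat_dead_subset (A W : Finset (Fin n)) (o b : Fin n) (hbA : b ∈ A) (hWA : Disjoint W A) :
    {ω : BondConfig (Fin n) | openCluster ω o = (W : Set (Fin n))} ⊆
      (openConn o b : Set (BondConfig (Fin n)))ᶜ ∩ (⋃ a ∈ A, (openConn o a : Set (BondConfig (Fin n))))ᶜ := by
  intro ω hω
  have hW : openCluster ω o = (W : Set (Fin n)) := hω
  have key : ∀ a ∈ A, ω ∉ (openConn o a : Set (BondConfig (Fin n))) := by
    intro a haA hωa
    have haC : a ∈ openCluster ω o := hωa
    rw [hW, Finset.mem_coe] at haC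
    exact Finset.disjoint_left.1 hWA haC haA
  refine ⟨key b hbA, ?_⟩
  simp only [Set.mem_compl_iff, Set.mem_iUnion, exists_prop, not_exists, not_and]
  exact key

/-- **High observer.** If the observer is itself at least as reliable as the level, `1 − t ≤ μ(o ↔ b)`, the
goodness inequality holds for every relay set `A ∋ b` and every selection: live failure and dead pockets are
disjoint sub-events of `{o ↮ b}`, whose probability is `≤ t`. [folklore; Kozma–Nitzan arXiv:2401.12397 §3.2] -/
theorem goodSat_of_le_observer (w : Sym2 (Fin n) → unitInterval) (A : Finset (Fin n)) (o b : Fin n)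
    (hbA : b ∈ A) (t : ℝ) (sel : Finset (Fin n) → Fin n)
    (ht : 1 - t ≤ (prodBernoulli w).real (openConn o b)) :
    (prodBernoulli w).real ((⋃ a ∈ A, openConn o a) ∩ (openConn o b)ᶜ)
      + ∑ W ∈ (Finset.univ : Finset (Finset (Fin n))).filter (fun W => o ∈ W ∧ Disjoint W A),
          (prodBernoulli w).real {ω : BondConfig (Fin n) | openCluster ω o = (W : Set (Fin n))}
            * (prodBernoulli w).real (openConnIn ((W : Set (Fin n))ᶜ) (sel W) b)ᶜ
      ≤ t := by
  have hpen : ∑ W ∈ (Finset.univ : Finset (Finset (Fin n))).filter (fun W => o ∈ W ∧ Disjoint W A),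
      (prodBernoulli w).real {ω : BondConfig (Fin n) | openCluster ω o = (W : Set (Fin n))}
        * (prodBernoulli w).real (openConnIn ((W : Set (Fin n))ᶜ) (sel W) b)ᶜ ≤
      (prodBernoulli w).real ((openConn o b : Set (BondConfig (Fin n)))ᶜ ∩
          (⋃ a ∈ A, (openConn o a : Set (BondConfig (Fin n))))ᶜ) :=
    goodSat_pocket_sum_le w o (fun W => o ∈ W ∧ Disjoint W A)
      (fun W => (prodBernoulli w).real (openConnIn ((W : Set (Fin n))ᶜ) (sel W) b)ᶜ)
      (fun W => measureReal_le_one) _ (fun W hW => goodSat_dead_subset A W o b hbA hW.2)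
  have hsplit : (prodBernoulli w).real ((⋃ a ∈ A, openConn o a) ∩ (openConn o b)ᶜ)
      + (prodBernoulli w).real ((openConn o b : Set (BondConfig (Fin n)))ᶜ ∩
          (⋃ a ∈ A, (openConn o a : Set (BondConfig (Fin n))))ᶜ) =
      (prodBernoulli w).real (openConn o b : Set (BondConfig (Fin n)))ᶜ := by
    rw [← measureReal_union (Set.disjoint_left.2 fun ω h1 h2 => h2.2 h1.1) (Set.toFinite _).measurableSet]
    congr 1
    ext ω
    simp only [Set.mem_union, Set.mem_inter_iff, Set.mem_compl_iff]
    tauto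
  have hcompl : (prodBernoulli w).real (openConn o b : Set (BondConfig (Fin n)))ᶜ =
      1 - (prodBernoulli w).real (openConn o b) :=
    probReal_compl_eq_one_sub (Set.toFinite _).measurableSet
  linarith

/-- **Monotonicity of goodness in the relay set.** At a fixed level `t`, the goodness inequality for `A` and all
selections into `A` implies it for every `S ⊆ A` with `b ∈ S` and all selections into `S`: the pockets dead for
`S` but not for `A` are disjoint sub-events of the live failure of `A` avoiding that of `S`.
[folklore; Kozma–Nitzan arXiv:2401.12397 §3.2] -/
theorem goodSat_mono (w : Sym2 (Fin n) → unitInterval) (A S : Finset (Fin n)) (o b : Fin n)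
    (hSA : S ⊆ A) (hbS : b ∈ S) (t : ℝ)
    (hgood : ∀ sel : Finset (Fin n) → Fin n, (∀ W, sel W ∈ A) →
      (prodBernoulli w).real ((⋃ a ∈ A, openConn o a) ∩ (openConn o b)ᶜ)
        + ∑ W ∈ (Finset.univ : Finset (Finset (Fin n))).filter (fun W => o ∈ W ∧ Disjoint W A),
            (prodBernoulli w).real {ω : BondConfig (Fin n) | openCluster ω o = (W : Set (Fin n))}
              * (prodBernoulli w).real (openConnIn ((W : Set (Fin n))ᶜ) (sel W) b)ᶜ
        ≤ t)
    (sel : Finset (Fin n) → Fin n) (hsel : ∀ W, sel W ∈ S) :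
    (prodBernoulli w).real ((⋃ a ∈ S, openConn o a) ∩ (openConn o b)ᶜ)
      + ∑ W ∈ (Finset.univ : Finset (Finset (Fin n))).filter (fun W => o ∈ W ∧ Disjoint W S),
          (prodBernoulli w).real {ω : BondConfig (Fin n) | openCluster ω o = (W : Set (Fin n))}
            * (prodBernoulli w).real (openConnIn ((W : Set (Fin n))ᶜ) (sel W) b)ᶜ
      ≤ t := by
  have hA := hgood sel fun W => hSA (hsel W)
  -- split the pockets dead for `S` into those dead for `A` and the rest
  set g : Finset (Fin n) → ℝ := fun W =>
    (prodBernoulli w).real {ω : BondConfig (Fin n) | openCluster ω o = (W : Set (Fin n))}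
      * (prodBernoulli w).real (openConnIn ((W : Set (Fin n))ᶜ) (sel W) b)ᶜ with hg
  have hsplit := (Finset.sum_filter_add_sum_filter_not
    ((Finset.univ : Finset (Finset (Fin n))).filter (fun W => o ∈ W ∧ Disjoint W S))
    (fun W => Disjoint W A) g).symm
  have hf1 : ((Finset.univ : Finset (Finset (Fin n))).filter (fun W => o ∈ W ∧ Disjoint W S)).filter
      (fun W => Disjoint W A) =
      (Finset.univ : Finset (Finset (Fin n))).filter (fun W => o ∈ W ∧ Disjoint W A) := by
    ext W
    simp only [Finset.mem_filter, Finset.mem_univ, true_and]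
    exact ⟨fun h => ⟨h.1.1, h.2⟩, fun h => ⟨⟨h.1, h.2.mono_right hSA⟩, h.2⟩⟩
  have hf2 : ((Finset.univ : Finset (Finset (Fin n))).filter (fun W => o ∈ W ∧ Disjoint W S)).filter
      (fun W => ¬ Disjoint W A) =
      (Finset.univ : Finset (Finset (Fin n))).filter (fun W => (o ∈ W ∧ Disjoint W S) ∧ ¬ Disjoint W A) := by
    ext W
    simp only [Finset.mem_filter, Finset.mem_univ, true_and]
  rw [hf1, hf2] at hsplit
  -- the rest is a sub-probability of the live failure of `A` avoiding that of `S`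
  have hsub : ∀ W, ((o ∈ W ∧ Disjoint W S) ∧ ¬ Disjoint W A) →
      {ω : BondConfig (Fin n) | openCluster ω o = (W : Set (Fin n))} ⊆
        (((⋃ a ∈ A, (openConn o a : Set (BondConfig (Fin n)))) ∩ (openConn o b)ᶜ) ∩
          (⋃ a ∈ S, (openConn o a : Set (BondConfig (Fin n))))ᶜ) := by
    intro W hW ω hω
    obtain ⟨⟨-, hWS⟩, hWA⟩ := hW
    have hW : openCluster ω o = (W : Set (Fin n)) := hω
    obtain ⟨a, haW, haA⟩ := Finset.not_disjoint_iff.1 hWA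
    have hdead := goodSat_dead_subset S W o b hbS hWS hω
    refine ⟨⟨Set.mem_iUnion₂.2 ⟨a, haA, ?_⟩, hdead.1⟩, hdead.2⟩
    have haC : a ∈ openCluster ω o := by rw [hW]; exact Finset.mem_coe.2 haW
    exact haC
  have hrest : ∑ W ∈ (Finset.univ : Finset (Finset (Fin n))).filter
      (fun W => (o ∈ W ∧ Disjoint W S) ∧ ¬ Disjoint W A), g W ≤
      (prodBernoulli w).real ((((⋃ a ∈ A, (openConn o a : Set (BondConfig (Fin n)))) ∩
        (openConn o b)ᶜ) ∩ (⋃ a ∈ S, (openConn o a : Set (BondConfig (Fin n))))ᶜ)) :=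
    goodSat_pocket_sum_le w o (fun W => (o ∈ W ∧ Disjoint W S) ∧ ¬ Disjoint W A)
      (fun W => (prodBernoulli w).real (openConnIn ((W : Set (Fin n))ᶜ) (sel W) b)ᶜ)
      (fun W => measureReal_le_one) _ hsub
  have hunion : (prodBernoulli w).real ((⋃ a ∈ S, openConn o a) ∩ (openConn o b)ᶜ)
      + (prodBernoulli w).real ((((⋃ a ∈ A, (openConn o a : Set (BondConfig (Fin n)))) ∩
          (openConn o b)ᶜ) ∩ (⋃ a ∈ S, (openConn o a : Set (BondConfig (Fin n))))ᶜ)) ≤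
      (prodBernoulli w).real ((⋃ a ∈ A, openConn o a) ∩ (openConn o b)ᶜ) := by
    rw [← measureReal_union (Set.disjoint_left.2 fun ω h1 h2 => h2.2 h1.1) (Set.toFinite _).measurableSet]
    refine measureReal_mono ?_
    rintro ω (⟨hU, hB⟩ | ⟨⟨hU, hB⟩, -⟩)
    · refine ⟨?_, hB⟩
      simp only [Set.mem_iUnion, exists_prop] at hU ⊢
      obtain ⟨a, haS, ha⟩ := hU
      exact ⟨a, hSA haS, ha⟩
    · exact ⟨hU, hB⟩
  have hpenA : ∑ W ∈ (Finset.univ : Finset (Finset (Fin n))).filter (fun W => o ∈ W ∧ Disjoint W A),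
      (prodBernoulli w).real {ω : BondConfig (Fin n) | openCluster ω o = (W : Set (Fin n))}
        * (prodBernoulli w).real (openConnIn ((W : Set (Fin n))ᶜ) (sel W) b)ᶜ =
      ∑ W ∈ (Finset.univ : Finset (Finset (Fin n))).filter (fun W => o ∈ W ∧ Disjoint W A), g W :=
    rfl
  have hpenS : ∑ W ∈ (Finset.univ : Finset (Finset (Fin n))).filter (fun W => o ∈ W ∧ Disjoint W S),
      (prodBernoulli w).real {ω : BondConfig (Fin n) | openCluster ω o = (W : Set (Fin n))}
        * (prodBernoulli w).real (openConnIn ((W : Set (Fin n))ᶜ) (sel W) b)ᶜ =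
      ∑ W ∈ (Finset.univ : Finset (Finset (Fin n))).filter (fun W => o ∈ W ∧ Disjoint W S), g W :=
    rfl
  rw [hpenA] at hA
  rw [hpenS, hsplit]
  linarith

/-- **Reduction to saturated relay sets with a sub-level observer.** Goodness at level `t` of all quadruples
`(A, o, b)` with `b ∈ A ∌ o` follows from goodness at level `t` of the SATURATED ones — `A` contains the whole
super-level set `{x | 1 − t ≤ μ(x ↔ b)}` — with an observer strictly below the level, `μ(o ↔ b) < 1 − t`
(`goodSat_of_le_observer` + `goodSat_mono` applied to `A ∪ {x | 1 − t ≤ μ(x ↔ b)}`; the level-set reduction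
of Kozma–Nitzan arXiv:2401.12397 §5.6 (4), in the selection form of the line). -/
theorem goodSat_reduction (w : Sym2 (Fin n) → unitInterval) (b : Fin n) (t : ℝ)
    (hsat : ∀ (A : Finset (Fin n)) (o : Fin n), b ∈ A → o ∉ A →
      (∀ x : Fin n, 1 - t ≤ (prodBernoulli w).real (openConn x b) → x ∈ A) →
      (prodBernoulli w).real (openConn o b) < 1 - t →
      (∀ a ∈ A, 1 - t ≤ (prodBernoulli w).real (openConn a b)) →
      ∀ sel : Finset (Fin n) → Fin n, (∀ W, sel W ∈ A) →
        (prodBernoulli w).real ((⋃ a ∈ A, openConn o a) ∩ (openConn o b)ᶜ)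
          + ∑ W ∈ (Finset.univ : Finset (Finset (Fin n))).filter (fun W => o ∈ W ∧ Disjoint W A),
              (prodBernoulli w).real {ω : BondConfig (Fin n) | openCluster ω o = (W : Set (Fin n))}
                * (prodBernoulli w).real (openConnIn ((W : Set (Fin n))ᶜ) (sel W) b)ᶜ
          ≤ t)
    (A : Finset (Fin n)) (o : Fin n) (hbA : b ∈ A) (hoA : o ∉ A)
    (hrel : ∀ a ∈ A, 1 - t ≤ (prodBernoulli w).real (openConn a b))
    (sel : Finset (Fin n) → Fin n) (hsel : ∀ W, sel W ∈ A) :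
    (prodBernoulli w).real ((⋃ a ∈ A, openConn o a) ∩ (openConn o b)ᶜ)
      + ∑ W ∈ (Finset.univ : Finset (Finset (Fin n))).filter (fun W => o ∈ W ∧ Disjoint W A),
          (prodBernoulli w).real {ω : BondConfig (Fin n) | openCluster ω o = (W : Set (Fin n))}
            * (prodBernoulli w).real (openConnIn ((W : Set (Fin n))ᶜ) (sel W) b)ᶜ
      ≤ t := by
  by_cases ho : 1 - t ≤ (prodBernoulli w).real (openConn o b)
  · exact goodSat_of_le_observer w A o b hbA t sel ho
  push Not at ho
  -- saturate `A` by the super-level set; `o` stays outside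
  set A' : Finset (Fin n) := A ∪ Finset.univ.filter (fun x : Fin n =>
    1 - t ≤ (prodBernoulli w).real (openConn x b)) with hA'
  have hAA' : A ⊆ A' := Finset.subset_union_left
  have hoA' : o ∉ A' := by
    rw [hA', Finset.mem_union, Finset.mem_filter]
    rintro (h | ⟨-, h⟩)
    · exact hoA h
    · exact absurd h (not_le.2 ho)
  have hsatA' : ∀ x : Fin n, 1 - t ≤ (prodBernoulli w).real (openConn x b) → x ∈ A' := fun x hx =>
    Finset.mem_union_right _ (Finset.mem_filter.2 ⟨Finset.mem_univ _, hx⟩)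
  have hrelA' : ∀ a ∈ A', 1 - t ≤ (prodBernoulli w).real (openConn a b) := by
    intro a ha
    rw [hA', Finset.mem_union, Finset.mem_filter] at ha
    rcases ha with ha | ⟨-, ha⟩
    · exact hrel a ha
    · exact ha
  exact goodSat_mono w A' A o b hAA' hbA t (hsat A' o (hAA' hbA) hoA' hsatA' ho hrelA') sel hsel

/-- **Registered sub-goal `stub_goodSatReduction_k22`** (closed form of `goodSat_reduction`): goodness at level `t`
of all quadruples follows from goodness of the saturated ones with a sub-level observer.  (Kozma–Nitzan
arXiv:2401.12397 §3.2 goodness, §5.6 (4) level-set reduction, in the selection form of the line.) -/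
theorem stub_goodSatReduction_k22 : ∀ (n : ℕ) (w : Sym2 (Fin n) → unitInterval) (b : Fin n) (t : ℝ), (∀ (A : Finset (Fin n)) (o : Fin n), b ∈ A → o ∉ A → (∀ x : Fin n, 1 - t ≤ (prodBernoulli w).real (openConn x b) → x ∈ A) → (prodBernoulli w).real (openConn o b) < 1 - t → (∀ a ∈ A, 1 - t ≤ (prodBernoulli w).real (openConn a b)) → ∀ (sel : Finset (Fin n) → Fin n), (∀ W, sel W ∈ A) → (prodBernoulli w).real ((⋃ a ∈ A, openConn o a) ∩ (openConn o b)ᶜ) + ∑ W ∈ (Finset.univ : Finset (Finset (Fin n))).filter (fun W => o ∈ W ∧ Disjoint W A), (prodBernoulli w).real {ω : BondConfig (Fin n) | openCluster ω o = (W : Set (Fin n))} * (prodBernoulli w).real (openConnIn ((W : Set (Fin n))ᶜ) (sel W) b)ᶜ ≤ t) → ∀ (A : Finset (Fin n)) (o : Fin n), b ∈ A → o ∉ A → (∀ a ∈ A, 1 - t ≤ (prodBernoulli w).real (openConn a b)) → ∀ (sel : Finset (Fin n) → Fin n), (∀ W, sel W ∈ A) → (prodBernoulli w).real ((⋃ a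 ∈ A, openConn o a) ∩ (openConn o b)ᶜ) + ∑ W ∈ (Finset.univ : Finset (Finset (Fin n))).filter (fun W => o ∈ W ∧ Disjoint W A), (prodBernoulli w).real {ω : BondConfig (Fin n) | openCluster ω o = (W : Set (Fin n))} * (prodBernoulli w).real (openConnIn ((W : Set (Fin n))ᶜ) (sel W) b)ᶜ ≤ t := by
  intro n w b t hsat A o hbA hoA hrel sel hsel
  exact goodSat_reduction w b t hsat A o hbA hoA hrel sel hsel

end

end Summit.CriticalPhenomena.PercolationContinuityZ3.Theorems
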